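import Summits.CriticalPhenomena.PercolationContinuityZ3.Theorems.Transplant.AutCocompactNilpotentStabilizers
import Summits.CriticalPhenomena.PercolationContinuityZ3.Theorems.Transplant.UniquenessAmenableCocompact
import HarnessLib

/-!
# The FG-free customers of «AutCocompactNilpotentStabilizers»: the Conjecture-1 dichotomy, Conjectures 1 + 4, and `p_u < 1` for EVERY cocompact action of a
# virtually nilpotent group — nothing else assumed

builds on p205010 (kernel theorem, internal audit signed; external expert review pending) — through «AutCocompactFinitelyGenerated» p595968 for the
`θ(p_c) = 0` clause only.  Lane `prim-bschramm`, seat `prim-bschramm-stmt` gen 38 (stmt port pen; lead g25 RULING #7809: 'the FG-free corollaries of F4 /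
F5b as a short customer file rather than edits').  Helper file (`--supports stmt-CriticalPhenomena-4575 --as helper`); PROOFS ONLY (def-free, no `instance`, no
notation); NOT by-name — the print nodes `BenjaminiSchramm1996_question3` / `LyonsPeres2016_conj_7_27` stay OPEN; STATEMENTS §5 unchanged; nothing about
`BenjaminiSchramm1996_conj4_endState`; bond percolation only.

* `criticalProb_lt_one_iff_of_virtuallyNilpotent` — SUPERSEDES «AutCocompactFinitelyGeneratedDichotomy» p596130's `criticalProb_lt_one_iff_of_fg_virtuallyNilpotent`
  as a statement (the `[Group.FG A]` binder dropped): for every action with finitely many orbits of a VIRTUALLY NILPOTENT group by automorphisms of a connected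
  locally finite graph, `p_c(x) < 1 ⟺ ¬ ∃ a, (zpowers a ⊔ ker (A → Perm W))` has finite index — p4 gen 22's quasi-transitive dichotomy on the faithful image,
  whose stabilisers are finite by «AutCocompactNilpotentStabilizers» (`finite_stabilizer_range_of_virtuallyNilpotent`), plus the index bookkeeping
  `index_zpowers_rangeRestrict` of p596130.
* `conj4_of_virtuallyNilpotent_cocompact_of_not_cyclicModKer` — Conjectures 1 + 4 together, nothing else assumed.
* `uniquenessProb_lt_one_of_virtuallyNilpotent_cocompact` — SUPERSEDES «UniquenessAmenableCocompact» p597507's `…_of_fg_…`: `p_u = p_c < 1` unless one element acts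
  with finite index modulo the kernel (the amenable half of Benjamini–Schramm Question 3 / Lyons–Peres Conj. 7.27 on the whole C2 action class).
[cite: BenjaminiSchramm1996, §2 Conj. 1, Conj. 4, Question 3 (p. 79)] [cite: LyonsPeres2016, §7.4 Cor. 7.19, Thm. 7.6, Conj. 7.27]
-/

noncomputable section

namespace Summit.CriticalPhenomena.PercolationContinuityZ3.Theorems.Transplant

namespace AutCyl

open SimpleGraph Literature.Barriers.CriticalPhenomena Literature.Probability.LatticeModels Literature.Probability.Percolation
open scoped Classical

variable {W : Type} {X : SimpleGraph W} {A : Type} [Group A] [MulAction A W] [X.LocallyFinite]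

/-! ## The Conjecture-1 dichotomy and its customers, NO finite-generation hypothesis -/

/-- **THE DICHOTOMY (Conjecture 1 form) FOR EVERY COCOMPACT ACTION OF A VIRTUALLY NILPOTENT GROUP — NOTHING ELSE ASSUMED** (supersedes
«AutCocompactFinitelyGeneratedDichotomy»'s `criticalProb_lt_one_iff_of_fg_virtuallyNilpotent` as a statement: the `[Group.FG A]` binder is dropped):
`p_c(X, x) < 1 ⟺` no element of `A` generates, together with the kernel of the action, a finite-index subgroup.
[cite: BenjaminiSchramm1996, §2 Conj. 1 (almost transitive graphs)] [cite: LyonsPeres2016, §7.4 Cor. 7.19; §7.9] -/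
theorem criticalProb_lt_one_iff_of_virtuallyNilpotent (hc : X.Connected) (hact : IsActionByAut X A) (reps : Finset W)
    (hcover : ∀ w : W, ∃ a : A, ∃ r ∈ reps, a • r = w) (N : Subgroup A) [N.FiniteIndex] [Group.IsNilpotent N] (x : W) :
    criticalProb X x < 1 ↔ ¬ ∃ a : A, (Subgroup.zpowers a ⊔ (MulAction.toPermHom A W).ker).FiniteIndex := by
  have he : Function.Surjective (MulAction.toPermHom A W).rangeRestrict := (MulAction.toPermHom A W).rangeRestrict_surjective
  haveI : (N.map (MulAction.toPermHom A W).rangeRestrict).FiniteIndex := ⟨fun h0 =>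
    Subgroup.FiniteIndex.index_ne_zero (Nat.eq_zero_of_zero_dvd (h0 ▸ Subgroup.index_map_dvd (H := N) he))⟩
  haveI : Group.IsNilpotent (N.map (MulAction.toPermHom A W).rangeRestrict) :=
    Group.nilpotent_of_surjective ((MulAction.toPermHom A W).rangeRestrict.subgroupMap N)
      ((MulAction.toPermHom A W).rangeRestrict.subgroupMap_surjective N)
  rw [VirtNilpotentAutQT.criticalProb_lt_one_iff_not_virtuallyCyclic (isActionByAut_range hact) hc reps (cover_range hcover)
    (fun r _ => finite_stabilizer_range_of_virtuallyNilpotent N hc hact reps hcover r) (N.map (MulAction.toPermHom A W).rangeRestrict) x,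
    not_iff_not]
  constructor
  · rintro ⟨c, hcfi⟩
    obtain ⟨a, rfl⟩ := he c
    exact ⟨a, ⟨by rw [← index_zpowers_rangeRestrict]; exact hcfi.index_ne_zero⟩⟩
  · rintro ⟨a, ha⟩
    exact ⟨(MulAction.toPermHom A W).rangeRestrict a, ⟨by rw [index_zpowers_rangeRestrict]; exact ha.index_ne_zero⟩⟩

/-- **CONJECTURES 1 AND 4 for every cocompact action of a virtually nilpotent group — nothing else assumed**: if no element acts with finite index modulo
the kernel, then `p_c(x) < 1` AND `θ_x(p_c) = 0` at every vertex («AutCocompactFinitelyGenerated»'s FG-free `conj4_of_virtuallyNilpotent_cocompact`).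
[cite: BenjaminiSchramm1996, §2 Conj. 1, Conj. 4 (almost transitive graphs)] -/
theorem conj4_of_virtuallyNilpotent_cocompact_of_not_cyclicModKer (hc : X.Connected) (hact : IsActionByAut X A) (reps : Finset W)
    (hcover : ∀ w : W, ∃ a : A, ∃ r ∈ reps, a • r = w) (N : Subgroup A) [N.FiniteIndex] [Group.IsNilpotent N]
    (hncyc : ¬ ∃ a : A, (Subgroup.zpowers a ⊔ (MulAction.toPermHom A W).ker).FiniteIndex) (x : W) :
    criticalProb X x < 1 ∧ theta X x (criticalProbIOf X x) = 0 :=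
  have hpc := (criticalProb_lt_one_iff_of_virtuallyNilpotent hc hact reps hcover N x).2 hncyc
  ⟨hpc, conj4_of_virtuallyNilpotent_cocompact hc hact reps hcover N x hpc⟩

/-- **`p_u = p_c < 1` for every cocompact action of a virtually nilpotent group unless one element acts with finite index modulo the kernel — NO
finite-generation hypothesis** (supersedes «UniquenessAmenableCocompact»'s `uniquenessProb_lt_one_of_fg_virtuallyNilpotent_cocompact` as a statement): the
amenable half of Benjamini–Schramm Question 3 / Lyons–Peres Conj. 7.27 on the whole C2 action class; the print nodes stay OPEN.
[cite: BenjaminiSchramm1996, Question 3 (p. 79)] [cite: LyonsPeres2016, Thm. 7.6, Conj. 7.27] -/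
theorem uniquenessProb_lt_one_of_virtuallyNilpotent_cocompact [DecidableEq W] (hc : X.Connected) (hact : IsActionByAut X A) (reps : Finset W)
    (hcover : ∀ w : W, ∃ a : A, ∃ r ∈ reps, a • r = w) (N : Subgroup A) [N.FiniteIndex] [Group.IsNilpotent N]
    (hncyc : ¬ ∃ a : A, (Subgroup.zpowers a ⊔ (MulAction.toPermHom A W).ker).FiniteIndex) (x : W) : uniquenessProb X < 1 := by
  rw [uniquenessProb_eq_criticalProb_of_virtuallyNilpotent_cocompact hc hact reps hcover N x]
  exact (criticalProb_lt_one_iff_of_virtuallyNilpotent hc hact reps hcover N x).2 hncyc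

end AutCyl

end Summit.CriticalPhenomena.PercolationContinuityZ3.Theorems.Transplant

end
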